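import Summits.KontsevichZagierPeriods.Zeta5Search.RecurrenceCertificate
import Summits.KontsevichZagierPeriods.Zeta5Search.CertificateMeasure
import HarnessLib

/-!
# ζ(5) search — `RecurrenceCertificateNeg`: FORMAT A′ for recurrences with `tₙ < 0` (cell `pub-zeta5`, TYPER)

HONEST FRAMING: systematic search; no irrationality claim unless certified.

`RecurrenceCertificate` (FORMAT A′, `RecurrenceCertificate.lean`) requires `tₙ > 0` in
`y(n+2) = sₙ y(n+1) - tₙ yₙ` (characteristic roots of the same sign: Apéry's `ζ(3)` recursion,
BZ-type families). The Catalan arm (criterion C3) and Apéry's `ζ(2)` recursion have the OTHER shape: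
`tₙ < 0`, characteristic roots of opposite signs (Zudilin 2003: `x² - 11x - 1`), for which the
ratio map `r ↦ sₙ - tₙ/r` is DECREASING and the box invariance reads `λ ≤ sₙ - tₙ/Λ`,
`sₙ - tₙ/λ ≤ Λ` (`RecurrenceGrowth.ratio_bounds_of_recurrence_neg`, used in `Zudilin2003Growth`).
This file is the finitary certificate for that shape, with the same conclusion:

* `structure RecurrenceCertificateNeg ξ` — as `RecurrenceCertificate` but `t_neg : tₙ < 0`,
  `negt_le : -tₙ ≤ τ`, corners `low : λ ≤ sₙ - tₙ/Λ`, `up : sₙ - tₙ/λ ≤ Λ`; margin `e^{δ₀}Λτ < λ²`;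
* `toApproximationCertificate`, `irrational` — **certificate ⇒ `ξ ∉ ℚ`** (growth by the decreasing
  ratio induction, Casoratian `|Wₙ| = (∏|tᵢ|)|W_N| ≤ τ^{n-N}|W_N|` by Abel, denominators by PNT);
* `catalanIrrational_of_recurrenceCertificateNeg` — the cell's Catalan target as an implication
  (no certificate exists: Zudilin's 2003 family has margin `< 0`, `NEAR-MISSES.md` row G).

Everything is PROVED (0 sorry); no instance is constructed.
-/

noncomputable section

open Filter Topology Finset
open Literature.NumberTheory.Transcendental

namespace Summit.KontsevichZagierPeriods.Zeta5Search

/-- **Finitary recurrence certificate, opposite-sign shape (`tₙ < 0`).** Two rational solutions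
`u, v` of `y(n+2) = sₙ y(n+1) - tₙ yₙ` (`n ≥ N`) with `tₙ < 0`, `-tₙ ≤ τ`, rational brackets
`1 < λ ≤ Λ` with `λ ≤ sₙ - tₙ/Λ` and `sₙ - tₙ/λ ≤ Λ` (`n ≥ N`), initial data at `N`, denominators
`Dₙ = ∏ᵢ lcm(1..cᵢn)^{kᵢ}` with `Dₙuₙ, Dₙvₙ ∈ ℤ` (`n ≥ N`), the limit `vₙ/uₙ → ξ`, and the margin
`e^{Σcᵢkᵢ}Λτ < λ²`. Then `ξ ∉ ℚ` (`RecurrenceCertificateNeg.irrational`). -/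
structure RecurrenceCertificateNeg (ξ : ℝ) where
  /-- the coefficient sequence of `ξ` -/
  u : ℕ → ℚ
  /-- the numerator sequence -/
  v : ℕ → ℚ
  /-- recurrence coefficient `sₙ` -/
  s : ℕ → ℚ
  /-- recurrence coefficient `tₙ` (negative) -/
  t : ℕ → ℚ
  /-- threshold index -/
  N : ℕ
  /-- lower ratio bound `λ > 1` -/
  lam : ℚ
  /-- upper ratio bound `Λ` -/
  Lam : ℚ
  /-- bound `τ ≥ |tₙ|` -/
  tau : ℚ
  /-- number of lcm factors -/
  m : ℕ
  /-- scales `cᵢ` of the lcm factors -/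
  c : Fin m → ℕ
  /-- exponents `kᵢ` of the lcm factors -/
  k : Fin m → ℕ
  /-- `u` solves the recurrence from `N` on -/
  rec_u : ∀ n, N ≤ n → u (n + 2) = s n * u (n + 1) - t n * u n
  /-- `v` solves the recurrence from `N` on -/
  rec_v : ∀ n, N ≤ n → v (n + 2) = s n * v (n + 1) - t n * v n
  /-- `λ > 1` -/
  one_lt_lam : 1 < lam
  /-- `λ ≤ Λ` -/
  lam_le : lam ≤ Lam
  /-- `tₙ < 0` -/
  t_neg : ∀ n, N ≤ n → t n < 0
  /-- `-tₙ ≤ τ` -/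
  negt_le : ∀ n, N ≤ n → -t n ≤ tau
  /-- lower corner `λ ≤ sₙ - tₙ/Λ` -/
  low : ∀ n, N ≤ n → lam ≤ s n - t n / Lam
  /-- upper corner `sₙ - tₙ/λ ≤ Λ` -/
  up : ∀ n, N ≤ n → s n - t n / lam ≤ Lam
  /-- `u N > 0` -/
  u_pos : 0 < u N
  /-- `λ u N ≤ u (N+1)` -/
  init_low : lam * u N ≤ u (N + 1)
  /-- `u (N+1) ≤ Λ u N` -/
  init_up : u (N + 1) ≤ Lam * u N
  /-- the Casoratian at `N` is non-zero -/
  casorati_init : u N * v (N + 1) - u (N + 1) * v N ≠ 0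
  /-- `Dₙ uₙ ∈ ℤ` for `n ≥ N` -/
  isInt_u : ∀ n, N ≤ n → ∃ z : ℤ, ((∏ i, Nat.lcmUpto (c i * n) ^ k i : ℕ) : ℚ) * u n = z
  /-- `Dₙ vₙ ∈ ℤ` for `n ≥ N` -/
  isInt_v : ∀ n, N ≤ n → ∃ z : ℤ, ((∏ i, Nat.lcmUpto (c i * n) ^ k i : ℕ) : ℚ) * v n = z
  /-- `vₙ/uₙ → ξ` -/
  tendsto_div : Tendsto (fun n : ℕ => (v n : ℝ) / (u n : ℝ)) atTop (𝓝 ξ)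
  /-- the multiplicative margin `e^{δ₀} Λ τ < λ²` -/
  margin : Real.exp (∑ i, ((c i * k i : ℕ) : ℝ)) * Lam * tau < (lam : ℝ) ^ 2

namespace RecurrenceCertificateNeg

variable {ξ : ℝ} (R : RecurrenceCertificateNeg ξ)

/-- The denominator exponent `δ₀ = Σ cᵢkᵢ`. -/
def denomRate₀ : ℝ := ∑ i, ((R.c i * R.k i : ℕ) : ℝ)

/-- The margin `η = 2 log λ - log Λ - log τ - δ₀`. -/
def eta : ℝ := 2 * Real.log R.lam - Real.log R.Lam - Real.log R.tau - R.denomRate₀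

/-- The slack `ε = min (η/5) (log λ/2)`. -/
def eps : ℝ := min (R.eta / 5) (Real.log R.lam / 2)

/-- **Basic positivity and the margin in logarithmic form** (one bundle): `λ, Λ, τ > 0`,
`log λ > 0`, `η > 0`, `ε > 0`, `ε ≤ η/5`, `ε ≤ log λ/2`. -/
theorem basics : (0 : ℝ) < R.lam ∧ (0 : ℝ) < R.Lam ∧ (0 : ℝ) < R.tau ∧ 0 < Real.log (R.lam : ℝ) ∧
    0 < R.eta ∧ 0 < R.eps ∧ R.eps ≤ R.eta / 5 ∧ R.eps ≤ Real.log R.lam / 2 := by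
  have hlam : (0 : ℝ) < R.lam := by
    have h : (1 : ℝ) < R.lam := by exact_mod_cast R.one_lt_lam
    linarith
  have hLam : (0 : ℝ) < R.Lam := by
    have h : (R.lam : ℝ) ≤ R.Lam := by exact_mod_cast R.lam_le
    linarith
  have htau : (0 : ℝ) < R.tau := by
    have h1 := R.t_neg R.N le_rfl
    have h2 := R.negt_le R.N le_rfl
    have : (0 : ℚ) < R.tau := by linarith
    exact_mod_cast this
  have hlog : 0 < Real.log (R.lam : ℝ) := Real.log_pos (by exact_mod_cast R.one_lt_lam)
  have heta : 0 < R.eta := by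
    have h := R.margin
    have hpos : 0 < Real.exp R.denomRate₀ * R.Lam * R.tau := by positivity
    have hlog' := Real.log_lt_log hpos h
    rw [Real.log_mul (by positivity) htau.ne', Real.log_mul (Real.exp_pos _).ne' hLam.ne',
      Real.log_exp, Real.log_pow] at hlog'
    unfold eta
    push_cast at hlog'
    linarith
  have heps : 0 < R.eps := lt_min (by linarith) (by linarith)
  exact ⟨hlam, hLam, htau, hlog, heta, heps, min_le_left _ _, min_le_right _ _⟩

/-- **Ratio bounds and sign** (decreasing ratio induction): for `n ≥ N`, `uₙ > 0`,
`λuₙ ≤ u_{n+1} ≤ Λuₙ`, and `tₙ < 0`. -/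
theorem ratio_bounds_neg : ∀ n, R.N ≤ n → (0 : ℝ) < R.u n ∧
    (R.lam : ℝ) * R.u n ≤ R.u (n + 1) ∧ (R.u (n + 1) : ℝ) ≤ R.Lam * R.u n ∧ (R.t n : ℝ) < 0 := by
  have hb := R.basics
  have h : ∀ n, R.N ≤ n → (0 : ℝ) < R.u n ∧
      (R.lam : ℝ) * R.u n ≤ R.u (n + 1) ∧ (R.u (n + 1) : ℝ) ≤ R.Lam * R.u n := by
    refine ratio_bounds_of_recurrence_neg (fun n => (R.u n : ℝ)) (fun n => (R.s n : ℝ))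
      (fun n => (R.t n : ℝ)) R.N ?_ ?_ hb.1 (by exact_mod_cast R.lam_le) ?_ ?_
      (by exact_mod_cast R.u_pos) (by exact_mod_cast R.init_low) (by exact_mod_cast R.init_up)
    · intro n hn; exact_mod_cast R.rec_u n hn
    · intro n hn; exact_mod_cast (R.t_neg n hn).le
    · intro n hn; exact_mod_cast R.low n hn
    · intro n hn; exact_mod_cast R.up n hn
  intro n hn
  obtain ⟨h1, h2, h3⟩ := h n hn
  exact ⟨h1, h2, h3, by exact_mod_cast R.t_neg n hn⟩

/-- **The Casoratian** (Abel): for `n ≥ N`, `Wₙ = (∏_{N≤i<n} tᵢ)·W_N ≠ 0` (it alternates in sign) and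
`|Wₙ| ≤ (|W_N|/τ^N)·e^{(log τ)n}`. -/
theorem casoratian_facts (n : ℕ) (hn : R.N ≤ n) :
    R.u n * R.v (n + 1) - R.u (n + 1) * R.v n =
        (∏ i ∈ Ico R.N n, R.t i) * (R.u R.N * R.v (R.N + 1) - R.u (R.N + 1) * R.v R.N) ∧
      R.u n * R.v (n + 1) - R.u (n + 1) * R.v n ≠ 0 ∧
      |((R.u n * R.v (n + 1) - R.u (n + 1) * R.v n : ℚ) : ℝ)| ≤
        |((R.u R.N * R.v (R.N + 1) - R.u (R.N + 1) * R.v R.N : ℚ) : ℝ)| / (R.tau : ℝ) ^ R.N *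
          Real.exp (Real.log R.tau * n) := by
  have hτ := R.basics.2.2.1
  have heq : R.u n * R.v (n + 1) - R.u (n + 1) * R.v n =
      (∏ i ∈ Ico R.N n, R.t i) * (R.u R.N * R.v (R.N + 1) - R.u (R.N + 1) * R.v R.N) :=
    casoratian_eq_prod_mul R.u R.v R.s R.t R.N R.rec_u R.rec_v n hn
  refine ⟨heq, ?_, ?_⟩
  · rw [heq]
    refine mul_ne_zero (prod_ne_zero_iff.2 fun i hi => ?_) R.casorati_init
    exact (R.t_neg i (mem_Ico.1 hi).1).ne
  · rw [heq]
    push_cast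
    rw [abs_mul]
    have hprod : |∏ i ∈ Ico R.N n, (R.t i : ℝ)| ≤ (R.tau : ℝ) ^ (n - R.N) := by
      rw [abs_prod]
      calc ∏ i ∈ Ico R.N n, |(R.t i : ℝ)| ≤ ∏ i ∈ Ico R.N n, (R.tau : ℝ) :=
            prod_le_prod (fun i _ => abs_nonneg _) fun i hi => by
              rw [abs_of_neg (by exact_mod_cast R.t_neg i (mem_Ico.1 hi).1)]
              exact_mod_cast R.negt_le i (mem_Ico.1 hi).1
        _ = (R.tau : ℝ) ^ (n - R.N) := by rw [prod_const, Nat.card_Ico]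
    have hexp : Real.exp (Real.log R.tau * n) = (R.tau : ℝ) ^ n := by
      rw [mul_comm, Real.exp_nat_mul, Real.exp_log hτ]
    rw [hexp]
    have hpow : (R.tau : ℝ) ^ (n - R.N) = (R.tau : ℝ) ^ n / (R.tau : ℝ) ^ R.N := by
      rw [eq_div_iff (pow_ne_zero _ hτ.ne'), ← pow_add, Nat.sub_add_cancel hn]
    calc |∏ i ∈ Ico R.N n, (R.t i : ℝ)| * |(R.u R.N : ℝ) * R.v (R.N + 1) - R.u (R.N + 1) * R.v R.N|
        ≤ (R.tau : ℝ) ^ (n - R.N) * |(R.u R.N : ℝ) * R.v (R.N + 1) - R.u (R.N + 1) * R.v R.N| :=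
          mul_le_mul_of_nonneg_right hprod (abs_nonneg _)
      _ = |(R.u R.N : ℝ) * R.v (R.N + 1) - R.u (R.N + 1) * R.v R.N| / (R.tau : ℝ) ^ R.N *
            (R.tau : ℝ) ^ n := by rw [hpow]; ring

/-- **The approximation certificate** built from the data (FORMAT A): growth exponents `log λ - ε`,
`log Λ + ε`, Casoratian rate `log τ`, denominator rate `δ₀ + ε`. -/
def toApproximationCertificate : ApproximationCertificate ξ where
  u := R.u
  v := R.v
  denom n := ∏ i, Nat.lcmUpto (R.c i * n) ^ R.k i
  growthLow := Real.log R.lam - R.eps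
  growthUp := Real.log R.Lam + R.eps
  casoratiConst := |((R.u R.N * R.v (R.N + 1) - R.u (R.N + 1) * R.v R.N : ℚ) : ℝ)| /
    (R.tau : ℝ) ^ R.N
  casoratiRate := Real.log R.tau
  denomRate := R.denomRate₀ + R.eps
  growthLow_pos := by linarith [R.basics.2.2.2.2.2.2.2, R.basics.2.2.2.1]
  denom_pos n := prod_lcmUpto_pow_pos R.c R.k n
  isInt_u := eventually_atTop.2 ⟨R.N, R.isInt_u⟩
  isInt_v := eventually_atTop.2 ⟨R.N, R.isInt_v⟩
  growth_lower := eventually_exp_le_of_ratio (fun n => (R.u n : ℝ)) R.N R.basics.1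
    (by exact_mod_cast R.u_pos) (fun n hn => (R.ratio_bounds_neg n hn).2.1)
    (by linarith [R.basics.2.2.2.2.2.1])
  growth_upper := eventually_le_exp_of_ratio (fun n => (R.u n : ℝ)) R.N R.basics.2.1
    (by exact_mod_cast R.u_pos) (fun n hn => (R.ratio_bounds_neg n hn).2.2.1)
    (by linarith [R.basics.2.2.2.2.2.1])
  casorati_le := eventually_atTop.2 ⟨R.N, fun n hn => (R.casoratian_facts n hn).2.2⟩
  casorati_ne := Eventually.frequently
    (eventually_atTop.2 ⟨R.N, fun n hn => (R.casoratian_facts n hn).2.1⟩)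
  tendsto_div := R.tendsto_div
  denom_le := by
    filter_upwards [eventually_prod_lcmUpto_pow_le_exp R.c R.k R.basics.2.2.2.2.2.1] with n hn
    unfold denomRate₀
    exact_mod_cast hn
  margin := by
    obtain ⟨-, -, -, -, h2, -, h1, -⟩ := R.basics
    have e : R.eta = 2 * Real.log R.lam - Real.log R.Lam - Real.log R.tau - R.denomRate₀ := rfl
    linarith

/-- **Certificate ⇒ irrational** (`tₙ < 0` shape). -/
theorem irrational (R : RecurrenceCertificateNeg ξ) : Irrational ξ :=
  ApproximationCertificate.irrational R.toApproximationCertificate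

/-- **Certificate ⇒ irrational AND measure**: `ξ ∉ ℚ` and `¬ LiouvilleWith p ξ` for every
`p > 1 + (Q' + δ)/μ₁` of the built approximation certificate, with `μ₁ = η - 4ε` (the Casoratian
never vanishes from `N` on). -/
theorem irrational_and_not_liouvilleWith (R : RecurrenceCertificateNeg ξ) {expo : ℝ}
    (hexpo : (R.toApproximationCertificate.growthUp + R.toApproximationCertificate.denomRate) /
      (R.eta - 4 * R.eps) + 1 < expo) :
    Irrational ξ ∧ ¬ LiouvilleWith expo ξ := by
  have hm : R.toApproximationCertificate.marginValue = R.eta - 4 * R.eps := by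
    simp only [ApproximationCertificate.marginValue, toApproximationCertificate, eta]
    ring
  refine ⟨R.irrational, R.toApproximationCertificate.not_liouvilleWith
    (eventually_atTop.2 ⟨R.N, fun n hn => (R.casoratian_facts n hn).2.1⟩) ?_⟩
  rw [hm]
  exact hexpo

end RecurrenceCertificateNeg

/-- **Catalan's constant**: a `RecurrenceCertificateNeg` for `catalanConstant` (the shape of
Zudilin's 2003 recursion) proves the tree's open statement `CatalanIrrational`. (Implication only;
Zudilin's family itself has margin `< 0`.) -/
theorem catalanIrrational_of_recurrenceCertificateNeg
    (R : RecurrenceCertificateNeg catalanConstant) : CatalanIrrational :=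
  R.irrational

/-- **`ζ(5)`**: likewise a `RecurrenceCertificateNeg` for `zetaValue 5` proves `ZetaFiveIrrational`. -/
theorem zetaFiveIrrational_of_recurrenceCertificateNeg
    (R : RecurrenceCertificateNeg (zetaValue 5)) : ZetaFiveIrrational :=
  R.irrational

end Summit.KontsevichZagierPeriods.Zeta5Search
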